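import Summits.QuantumFields.YangMills.Theorems.IR.VacuumEscapePhysicalTimeSpectral
import Mathlib.Analysis.SpecialFunctions.Pow.Real
import HarnessLib

/-!
# Line `vacuum_escape` (crux `BalabanLadder.IR`, stmt-QuantumFields-19354) — physical-time currency, part 3a: scalar bookkeeping

Small lemmas shared by parts 3b–4 of the equivalence `PhysicalTimeConductance ↔ SliceGapInUnits` (census B6; pooled prover ym-ir-line-pool-p3):
normalising ratios of spectral sums with the denominator `n` powers ahead (`ratio_eq_of_hasSum_add`), `n`-th roots (`le_rpow_inv_of_pow_le`,
`rpow_inv_le_exp`), ratio extraction from an exponential trace bound (`le_of_pow_le_mul_pow`), and transport of a cyclic integral with insertions at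
`0` and `p` along an equality of cycle lengths (`integral_cyclic_cast_lag`).  [folklore]

HONEST FRAMING: a format equivalence between two typed currencies of ONE line of an open crux of a CONDITIONAL chain; the content of the line
(the LOAD `stub_noStickySliceEvent`, weak-coupling volume-uniform isoperimetry) is untouched; nothing here proves `BalabanLadder.IR`, a lattice
gap, or the Yang–Mills mass gap (Clay); R4 of the ladder closes only `BalabanLadder.UV`.
-/

set_option autoImplicit false

noncomputable section

open MeasureTheory Filter Set Function
open scoped Topology

namespace Summit.QuantumFields.YangMills.Cruxes.IR.VacuumEscape



/-- Normalising a ratio of spectral sums by the top eigenvalue, the denominator `n` powers ahead. -/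
theorem ratio_eq_of_hasSum_add {ι : Type*} {lam r c : ι → ℝ} {lam₀ : ℝ} (hL0 : lam₀ ≠ 0)
    (hr : ∀ i, lam i = lam₀ * r i) (j n : ℕ) {Nu De : ℝ} (hN : HasSum (fun i => lam i ^ j * c i) Nu)
    (hD : HasSum (fun i => lam i ^ (j + n)) De) :
    Nu / De = (lam₀ ^ n)⁻¹ * ((∑' i, r i ^ j * c i) / (∑' i, r i ^ (j + n))) := by
  have hp : lam₀ ^ j ≠ 0 := pow_ne_zero _ hL0
  have hpn : lam₀ ^ n ≠ 0 := pow_ne_zero _ hL0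
  have hp1 : lam₀ ^ (j + n) ≠ 0 := pow_ne_zero _ hL0
  have h1 : HasSum (fun i => r i ^ j * c i) (Nu / lam₀ ^ j) := by
    refine (hN.div_const (lam₀ ^ j)).congr_fun fun i => ?_
    rw [hr i, mul_pow]; field_simp
  have h2 : HasSum (fun i => r i ^ (j + n)) (De / lam₀ ^ (j + n)) := by
    refine (hD.div_const (lam₀ ^ (j + n))).congr_fun fun i => ?_
    rw [hr i, mul_pow]; field_simp
  rw [h1.tsum_eq, h2.tsum_eq, pow_add]
  field_simp

/-- If `0 ≤ ρ ≤ 1` and `ρⁿ ≤ U` (`n ≥ 1`, `0 ≤ U`) then `ρ ≤ U^{1/n}`. -/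
theorem le_rpow_inv_of_pow_le {ρ U : ℝ} {n : ℕ} (hρ : 0 ≤ ρ) (hU : 0 ≤ U) (hn : 1 ≤ n) (h : ρ ^ n ≤ U) :
    ρ ≤ U ^ ((1 : ℝ) / n) := by
  have hn0 : (n : ℝ) ≠ 0 := by exact_mod_cast (show n ≠ 0 by omega)
  have hv0 : 0 ≤ U ^ ((1 : ℝ) / n) := Real.rpow_nonneg hU _
  have hvn : (U ^ ((1 : ℝ) / n)) ^ n = U := by
    rw [← Real.rpow_natCast, ← Real.rpow_mul hU, one_div_mul_cancel hn0, Real.rpow_one]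
  rw [← hvn] at h
  exact (pow_le_pow_iff_left₀ hρ hv0 (by omega)).1 h

/-- `(e^{-x})^{1/n} = e^{-x/n}` packaged as the bound used below: `U ≤ e^{-x}` gives `U^{1/n} ≤ e^{-(x/n)}`. -/
theorem rpow_inv_le_exp {U x : ℝ} {n : ℕ} (hU : 0 ≤ U) (hn : 1 ≤ n) (h : U ≤ Real.exp (-x)) :
    U ^ ((1 : ℝ) / n) ≤ Real.exp (-(x / n)) := by
  have h1 : U ^ ((1 : ℝ) / n) ≤ Real.exp (-x) ^ ((1 : ℝ) / n) :=
    Real.rpow_le_rpow hU h (by positivity)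
  refine h1.trans (le_of_eq ?_)
  rw [← Real.exp_mul]
  congr 1
  field_simp



/-- Ratio extraction: `0 < q` and `ρ^{m+2} ≤ X q^{m+2}` for all `m` force `ρ ≤ q`. -/
theorem le_of_pow_le_mul_pow {ρ q X : ℝ} (hq : 0 < q) (h : ∀ m : ℕ, ρ ^ (m + 2) ≤ X * q ^ (m + 2)) :
    ρ ≤ q := by
  by_contra hlt
  have hqρ : q < ρ := lt_of_not_ge hlt
  have hgt : 1 < ρ / q := (one_lt_div hq).2 hqρ
  have hbd : ∀ m : ℕ, (ρ / q) ^ (m + 2) ≤ X := by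
    intro m
    rw [div_pow, div_le_iff₀ (pow_pos hq _)]
    exact h m
  have htend := tendsto_pow_atTop_atTop_of_one_lt hgt
  have hev : ∀ᶠ m : ℕ in atTop, X + 1 ≤ (ρ / q) ^ m := htend.eventually_ge_atTop (X + 1)
  obtain ⟨m₀, hm₀⟩ := eventually_atTop.1 hev
  have h1 := hm₀ (m₀ + 2) (by omega)
  have h2 := hbd m₀
  linarith


/-- Transport of a cyclic integral with insertions at `0` and `p` along an equality of cycle lengths. -/
theorem integral_cyclic_cast_lag {Y : Type*} [MeasurableSpace Y] (ν : Measure Y) {n₁ n₂ : ℕ} [NeZero n₁] [NeZero n₂]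
    (hc : n₁ = n₂) (Ψ : Y → Y → ℝ) (f g : Y → ℝ) (p : Fin n₁) :
    ∫ W : Fin n₂ → Y, f (W 0) * g (W (Fin.cast hc p)) * ∏ s, Ψ (W s) (W (s + 1)) ∂(Measure.pi fun _ => ν) =
      ∫ V : Fin n₁ → Y, f (V 0) * g (V p) * ∏ s, Ψ (V s) (V (s + 1)) ∂(Measure.pi fun _ => ν) := by
  subst hc
  rfl


end Summit.QuantumFields.YangMills.Cruxes.IR.VacuumEscape

end
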